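import Summits.CriticalPhenomena.SAWScalingLimit.Theses.SAWExpectedSignature
import Literature.Probability.RandomPlanarGeometry.SLEExistenceNeEightHolds
import HarnessLib.Audit

/-!
# Split — typed decomposition of the crux `MomentsIdentifySLE` (stmt-CriticalPhenomena-5888)

`MomentsIdentifySLE ⟸ SigLimitIsSLE ∧ SLESigDeterminacy ∧ SimpleLawFromSigLaw` (crux-strategist
planner-cstrat-stmt-CriticalPhenomena-5888-r1-0, 2026-08-17). The pieces cut the moment-method identification
along its classical seams: (1) `SigLimitIsSLE` — if all lattice expected-signature coefficients converge,
their limits are the expected signature of the chordal SLE(8/3) law of `(D; a, b)`, which is then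
Young-regular (finite `q`-variation moments of all orders for some `q < 2`, integrable coefficients)
[lattice / conformal content]; (2) `SLESigDeterminacy` — the expected signature of a Young-regular SLE(8/3)
law determines the JOINT LAW of the signature coefficients among finite-moment laws [moment determinacy,
rough paths]; (3) `SimpleLawFromSigLaw` — a simple law pinned at `a` whose signature coefficients have the
same joint law as under a Young-regular SLE(8/3) law is that law [uniqueness of signature for simple
curves, Boedihardjo–Ni–Qian 2014 + Lusin–Souslin; support-grade]. The glue uses the tree's PROVED
existence of the chordal SLE(8/3) law (`exists_isSLELaw_of_ne_eight`, Rohde–Schramm Thm 5.1/7.1).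
-/

namespace Summit.CriticalPhenomena.SAWScalingLimit.Cruxes.MomentsIdentifySLE.Split

open Summit.CriticalPhenomena.SAWScalingLimit.Theses.SAWExpectedSignature (MomentsIdentifySLE)

open scoped BigOperators Topology Manifold Classical MeasureTheory ProbabilityTheory Matrix InnerProductSpace ComplexConjugate ContinuousMap
open Filter Set Function TopologicalSpace MeasureTheory

/-- piece 1 (crux): if every lattice expected-signature coefficient converges, the limits are the
expected signature of the chordal SLE(8/3) law of `(D; a, b)`, which is Young-regular. -/
def SigLimitIsSLE : Prop :=
  ∀ (D : Literature.Probability.RandomPlanarGeometry.DobrushinDomain) (a b : ℝ → Literature.Probability.LatticeModels.Site 2), Literature.Probability.RandomPlanarGeometry.SAW.IsEndpointApprox D a b → let pv : ℝ → Literature.Probability.RandomPlanarGeometry.Curve ℂ → ENNReal := fun p c => ⨆ π : ℕ × {u : ℕ → unitInterval // Monotone u}, ∑ i ∈ Finset.range π.1, edist (c (π.2.1 (i + 1))) (c (π.2.1 i)) ^ p; let sig : List (Fin 2) → Literature.Probability.RandomPlanarGeometry.Curve ℂ → ℝ := fun w c => limUnder Filter.atTop (fun n : ℕ => ∑ k ∈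 (Finset.univ : Finset (Fin w.length → Fin (2 ^ n))).filter (fun k => StrictMono k), ∏ j : Fin w.length, (if w.get j = 0 then Complex.re else Complex.im) (c (Set.projIcc (0 : ℝ) 1 zero_le_one ((((k j : ℕ) : ℝ) + 1) / 2 ^ n)) - c (Set.projIcc (0 : ℝ) 1 zero_le_one (((k j : ℕ) : ℝ) / 2 ^ n)))); let rep : Literature.Probability.RandomPlanarGeometry.CurveClass ℂ → Literature.Probability.RandomPlanarGeometry.Curve ℂ := fun x => (Literature.Probability.RandomPlanarGeometry.CurveClass.surjective_mk x).choose; let poly : (δ : ℝ) → Literature.Probability.RandomPlanarGeometry.SAW.DomainSAW D.carrier δ (a δ) (b δ) → Literature.Probability.RandomPlanarGeometry.Curve ℂ := fun δ γ => ⟨γ.walk.toCurve (Literature.Probability.LatticeModels.meshPoint δ)⟩; ∀ μ : MeasureTheory.Measure (Literature.Probability.RandomPlanarGeometry.CurveClass ℂ), Literature.Probability.RandomPlanarGeometry.IsSLELaw ((8 : NNReal) / 3) D μ → ∀ s : List (Fin 2) → ℝ, (∀ w : List (Fin 2), Filter.Tendsto (fun δ => ∫ γ, sig w (poly δ γ)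 ∂(Literature.Probability.RandomPlanarGeometry.SAW.law D.carrier δ (a δ) (b δ))) (nhdsWithin 0 (Set.Ioi 0)) (nhds (s w))) → ∃ q : ℝ, 1 ≤ q ∧ q < 2 ∧ (∀ n : ℕ, ∫⁻ x, pv q (rep x) ^ (n : ℝ) ∂μ ≠ ⊤) ∧ ∀ w : List (Fin 2), MeasureTheory.Integrable (fun x => sig w (rep x)) μ ∧ ∫ x, sig w (rep x) ∂μ = s w

/-- piece 2 (crux): expected-signature determinacy anchored at a Young-regular SLE(8/3) law — equal
expected signatures (with finite variation moments of all orders on both sides) force equal joint laws of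
the signature coefficients. -/
def SLESigDeterminacy : Prop :=
  ∀ (D : Literature.Probability.RandomPlanarGeometry.DobrushinDomain), let pv : ℝ → Literature.Probability.RandomPlanarGeometry.Curve ℂ → ENNReal := fun p c => ⨆ π : ℕ × {u : ℕ → unitInterval // Monotone u}, ∑ i ∈ Finset.range π.1, edist (c (π.2.1 (i + 1))) (c (π.2.1 i)) ^ p; let sig : List (Fin 2) → Literature.Probability.RandomPlanarGeometry.Curve ℂ → ℝ := fun w c => limUnder Filter.atTop (fun n : ℕ => ∑ k ∈ (Finset.univ : Finset (Fin w.length → Fin (2 ^ n))).filter (fun k => StrictMono k), ∏ j : Fin w.length, (if w.get j = 0 then Complex.re else Complex.im) (c (Set.projIcc (0 : ℝ) 1 zero_le_one ((((k j : ℕ) : ℝ) + 1) / 2 ^ n)) - c (Set.projIcc (0 : ℝ) 1 zero_le_one (((k j : ℕ) : ℝ) / 2 ^ n)))); let rep : Literature.Probability.RandomPlanarGeometry.CurveClass ℂ → Literature.Probability.RandomPlanarGeometry.Curve ℂ := fun x => (Literature.Probability.RandomPlanarGeometry.CurveClass.surjective_mk x).choose; ∀ (p q : ℝ), 1 ≤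 p → p < 2 → 1 ≤ q → q < 2 → ∀ μ ν : MeasureTheory.Measure (Literature.Probability.RandomPlanarGeometry.CurveClass ℂ), Literature.Probability.RandomPlanarGeometry.IsSLELaw ((8 : NNReal) / 3) D μ → MeasureTheory.IsProbabilityMeasure ν → (∀ n : ℕ, ∫⁻ x, pv q (rep x) ^ (n : ℝ) ∂μ ≠ ⊤) → (∀ n : ℕ, ∫⁻ x, pv p (rep x) ^ (n : ℝ) ∂ν ≠ ⊤) → (∀ w : List (Fin 2), MeasureTheory.Integrable (fun x => sig w (rep x)) μ ∧ MeasureTheory.Integrable (fun x => sig w (rep x)) ν ∧ ∫ x, sig w (rep x) ∂ν = ∫ x, sig w (rep x) ∂μ) → ∀ (ws : List (List (Fin 2))) (F : BoundedContinuousFunction (Fin ws.length → ℝ) ℝ), ∫ x, F (fun i => sig (ws.get i) (rep x)) ∂ν = ∫ x, F (fun i => sig (ws.get i) (rep x)) ∂μ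

/-- piece 3 (support): a simple law pinned at `a = D.pt 0` with finite variation moments whose signature
coefficients have the same joint law as under a Young-regular SLE(8/3) law of `D` is that law. -/
def SimpleLawFromSigLaw : Prop :=
  ∀ (D : Literature.Probability.RandomPlanarGeometry.DobrushinDomain), let pv : ℝ → Literature.Probability.RandomPlanarGeometry.Curve ℂ → ENNReal := fun p c => ⨆ π : ℕ × {u : ℕ → unitInterval // Monotone u}, ∑ i ∈ Finset.range π.1, edist (c (π.2.1 (i + 1))) (c (π.2.1 i)) ^ p; let sig : List (Fin 2) → Literature.Probability.RandomPlanarGeometry.Curve ℂ → ℝ := fun w c => limUnder Filter.atTop (fun n : ℕ => ∑ k ∈ (Finset.univ : Finset (Fin w.length → Fin (2 ^ n))).filter (fun k => StrictMono k), ∏ j : Fin w.length, (if w.get j = 0 then Complex.re else Complex.im) (c (Set.projIcc (0 : ℝ) 1 zero_le_one ((((k j : ℕ) : ℝ) + 1) / 2 ^ n)) - c (Set.projIcc (0 : ℝ) 1 zero_le_one (((k j : ℕ) : ℝ) / 2 ^ n)))); let rep : Literature.Probability.RandomPlanarGeometry.CurveClass ℂ → Literature.Probability.RandomPlanarGeometry.Curve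 ℂ := fun x => (Literature.Probability.RandomPlanarGeometry.CurveClass.surjective_mk x).choose; ∀ (p q : ℝ), 1 ≤ p → p < 2 → 1 ≤ q → q < 2 → ∀ μ ν : MeasureTheory.Measure (Literature.Probability.RandomPlanarGeometry.CurveClass ℂ), Literature.Probability.RandomPlanarGeometry.IsSLELaw ((8 : NNReal) / 3) D μ → MeasureTheory.IsProbabilityMeasure ν → (∀ n : ℕ, ∫⁻ x, pv q (rep x) ^ (n : ℝ) ∂μ ≠ ⊤) → (∀ n : ℕ, ∫⁻ x, pv p (rep x) ^ (n : ℝ) ∂ν ≠ ⊤) → ν (Literature.Probability.RandomPlanarGeometry.CurveClass.simple)ᶜ = 0 → ν {x | x.source ≠ D.pt 0} = 0 → (∀ (ws : List (List (Fin 2))) (F : BoundedContinuousFunction (Fin ws.length → ℝ) ℝ), ∫ x, F (fun i => sig (ws.get i) (rep x)) ∂ν = ∫ x, F (fun i => sig (ws.get i) (rep x)) ∂μ) → ν = μ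

/-- ASSEMBLY of the split: the three pieces imply the crux `MomentsIdentifySLE` by name. -/
theorem MomentsIdentifySLE_of_subs :
    SigLimitIsSLE → SLESigDeterminacy → SimpleLawFromSigLaw → MomentsIdentifySLE := by
  intro h1 h2 h3 D a b hab
  dsimp only
  intro p hp1 hp2 ν hν hmom hsimp hsrc hsig
  -- the chordal SLE(8/3) law `μ` of `D` exists (Rohde–Schramm Thm 5.1 / 7.1, proved in the tree)
  obtain ⟨μ, hμ⟩ :=
    Literature.Probability.RandomPlanarGeometry.exists_isSLELaw_of_ne_eight (κ := (8 : NNReal) / 3)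
      (by positivity) (by norm_num) D
  -- piece 1, fed with the lattice limits carried by `ν` (hypothesis (iv)): `μ` is Young-regular with
  -- exponent `q`, its signature coefficients are integrable and their expectations are those limits
  have h1' := h1 D a b hab
  dsimp only at h1'
  obtain ⟨q, hq1, hq2, hmomμ, hS⟩ := h1' μ hμ _ (fun w => (hsig w).2)
  -- piece 2: the joint laws of the signature coefficients under `ν` and `μ` agree
  have h2' := h2 D
  dsimp only at h2'
  have hlaw := h2' p q hp1 hp2 hq1 hq2 μ ν hμ hν hmomμ hmom
    (fun w => ⟨(hS w).1, (hsig w).1, (hS w).2.symm⟩)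
  -- piece 3: a simple pinned finite-moment law with the SLE signature law is the SLE law
  have h3' := h3 D
  dsimp only at h3'
  have hνμ : ν = μ := h3' p q hp1 hp2 hq1 hq2 μ ν hμ hν hmomμ hmom hsimp hsrc hlaw
  rw [hνμ]
  exact hμ

end Summit.CriticalPhenomena.SAWScalingLimit.Cruxes.MomentsIdentifySLE.Split
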